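import Summits.Langlands.Langlands.Theses.ParityBlindBianchi
import Literature.NumberTheory.Automorphic.BaseChangeCyclicCuspidal
import Literature.NumberTheory.Automorphic.BaseChangeStrongUnramified
import Literature.NumberTheory.Automorphic.BaseChangeArchimedean
import Literature.NumberTheory.Automorphic.SerreConjecture

/-!
# Sketch (crux-ideate r1 k1) — first lemmas for crux `ParityBlindBianchi.ResidualBianchiDoorLevel`
(item stmt-Langlands-15112). Signatures only (sorried); they must elaborate.

Card `serrekw-ctwist-strong-bc`: E1′ = (ℚ-level C-normalised congruence package, K-free, from the
landed SerreKW stubs) + (uniform-in-K strong quadratic base change transfer). The one new named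
fact the transfer needs is `StrongLiftingAllFinite` (Arthur–Clozel Ch. 3 Thm 5.1 at ALL finite
places where `π_v` is unramified, including `v` ramified in `E/F`).
-/

namespace Summit.Langlands.Langlands.Cruxes.ResidualBianchiDoorLevel.SketchIdeator1

open Literature.NumberTheory.Automorphic Literature.NumberTheory.GaloisRepresentations
open NumberField IsDedekindDomain

/-- **R1 (wanted named fact).** Arthur–Clozel, Ch. 3, Thm. 5.1 ("if `Π` is a weak lifting of `π`,
then `Π` is in fact a strong lifting", book p. 181) with Def. 1.2 and Ch. 1 Thm. 6.2 / §6.2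
(local lifting commutes with parabolic induction; the lift of an unramified `π(χ₁,…,χₙ)` along ANY
cyclic `E_w/F_v` of prime degree is `π(χ₁∘N,…,χₙ∘N)`, unramified, with Satake parameter
`α^{f(w|v)}`): the relation (1.1) at EVERY finite place `w` over a `v` at which `π` is unramified —
also at the `v` ramified in `E/F` (there `f(w|v) = 1`). Subsumes clause (i) of
`ArthurClozel1989_strongLifting_unramified`. -/
def StrongLiftingAllFinite : Prop :=
  ∀ (n : ℕ) (F E : Type) [Field F] [NumberField F] [Field E] [NumberField E] [Algebra F E]
    [IsGalois F E], (Module.finrank F E).Prime →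
    ∀ (hF : isCompact_glFiniteIntegralLevel n F) (hE : isCompact_glFiniteIntegralLevel n E)
      (π : CuspidalAutomorphicRepData n F hF) (P : CuspidalAutomorphicRepData n E hE),
      IsWeakBaseChangeLiftAE π.1 P.1 →
        ∀ (w : HeightOneSpectrum (𝓞 E)) (v : HeightOneSpectrum (𝓞 F)) (α : Multiset ℂ),
          w.asIdeal.under (𝓞 F) = v.asIdeal → π.1.HasSatakeParamAt v α →
            P.1.HasSatakeParamAt w (α.map (· ^ w.asIdeal.inertiaDeg (𝓞 F)))

/-- The **ℚ-level congruence package at tame level `S`** (C-normalisation `m = 2`, regular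
algebraic): the residual hypothesis of `TwoAdicBianchiProModularityLevel` read over `ℚ` for the
`2`-adic model `σ₀ = GL₂(ι⁻¹) ∘ ρ`, at EVERY place outside `S`. -/
def QLevelCongruent (ι : PadicAlgCl 2 ≃+* ℂ) (σ₀ : FramedGaloisRep ℚ (PadicAlgCl 2) 2) (S : Finset ℕ)
    (hcpt : isCompact_glFiniteIntegralLevel 2 ℚ) (π : CuspidalAutomorphicRepData 2 ℚ hcpt) : Prop :=
  π.1.IsRegularAlgebraic ∧
    ∀ v : HeightOneSpectrum (𝓞 ℚ), (∀ ℓ ∈ S, ((ℓ : ℕ) : 𝓞 ℚ) ∉ v.asIdeal) →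
      ∃ (α : Multiset ℂ) (P : Polynomial (PadicAlgCl 2)), π.1.HasSatakeParamAt v α ∧
        σ₀.IsUnramifiedAt v ∧ σ₀.HasFrobCharpolyAt v P ∧
        ∀ i : ℕ, ‖P.coeff i - (arithFrobPolyOfSatake ι v.residueCard 2 α).coeff i‖ < 1

/-- **First lemma, ℚ-side (`stub_qLevel`)**: from Khare–Wintenberger (the tree's named fact, all
`p`, `k`) — in fact only `p = 2` is used — every irreducible icosahedral Artin `ρ` over `ℚ` has, for
every `ι`, a finite `S ∋ 2` and a regular algebraic cuspidal `π_ℚ` on `GL₂(𝔸_ℚ)` congruent to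
`σ₀ = GL₂(ι⁻¹)∘ρ` at every place outside `S`.  Route: integral model + reduction of `σ₀`
(`exists_integralModel_of_valuationSubring`), `σ̄₀` irreducible (`A₅` survives: odd-order torsion
in the kernel of reduction is trivial; reducible ⇒ solvable image) and odd (`isOdd_of_charP_two`);
the six landed stubs of `Cruxes/SerreKWAutomorphicGL2` (KW newform `g`, residue-adapted embedding,
conjugate newform, adelic lift, arch parameter `{(w-1)/2,(1-w)/2}`, dictionary) repackaged in the
C-normalisation (`⊗ ε⁻¹ ⊗ |det|^{(w-2)/2}` instead of `|det|^{(w-1)/2}`; `w ∈ {2,4}` is even by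
`isSerreWeight_two_cases`, so the type is regular C-algebraic); the a.e. exceptional set is
ABSORBED into `S` (which is chosen after `ρ, ι`). -/
theorem stub_qLevel
    (hKW : ∀ (p : ℕ) [Fact p.Prime] (k : Type) [Field k] [TopologicalSpace k] [DiscreteTopology k],
      khare_wintenberger p k)
    (ι : PadicAlgCl 2 ≃+* ℂ) (ρ : FramedGaloisRep ℚ ℂ 2) (hirr : ρ.toGaloisRep.IsIrreducible)
    (hA5 : Nonempty ((Matrix.ProjGenLinGroup.mk.comp ρ.toMonoidHom).range ≃*
      alternatingGroup (Fin 5))) :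
    ∃ S : Finset ℕ, 2 ∈ S ∧ ∃ σ₀ : FramedGaloisRep ℚ (PadicAlgCl 2) 2,
      σ₀.toMonoidHom = (Matrix.GeneralLinearGroup.map ι.symm.toRingHom).comp ρ.toMonoidHom ∧
      ∃ (hcpt : isCompact_glFiniteIntegralLevel 2 ℚ) (π : CuspidalAutomorphicRepData 2 ℚ hcpt),
        QLevelCongruent ι σ₀ S hcpt π := by
  sorry

/-- **First lemma, K-side (`stub_bcTransfer`, the crux-specific content)**: uniform-in-`K` strong
quadratic base change of the ℚ-level package.  Granted Arthur–Clozel 4.2 (a)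
(`baseChange_cyclic_cuspidal`), 5.1 archimedean (`ArthurClozel1989_strongLifting_archimedean`) and
R1 (`StrongLiftingAllFinite`): for EVERY quadratic number field `K` (imaginary / 2-split not used)
there is a regular algebraic cuspidal `π₀` on `GL₂(𝔸_K)` congruent to `σ₀|_K` at every place of `K`
over no prime of the SAME `S`.  Cuspidality for all `K` at once: Chebotarev (proved,
`chebotarev_artinRep_holds`) gives an inert `p ∉ S` whose Frobenius has projective order `5`, so
`tr σ̄₀(Frob_p) ≠ 0`, so `tr t_{π_ℚ,p} ≠ 0` (`map_neg_ne_of_sum_ne_zero`); places over `p ∉ S`: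
split/ramified `f = 1` (same Satake, `Frob_w ↦ Frob_p`), inert `f = 2` (`α²`, `q_w = p²`,
`charpoly(A²) = X² - (t²-2d)X + d²`). -/
theorem stub_bcTransfer
    (hBC : baseChange_cyclic_cuspidal) (hArch : ArthurClozel1989_strongLifting_archimedean)
    (hR1 : StrongLiftingAllFinite)
    (ι : PadicAlgCl 2 ≃+* ℂ) (σ₀ : FramedGaloisRep ℚ (PadicAlgCl 2) 2)
    (hfin : Finite σ₀.toMonoidHom.range)
    (hA5 : Nonempty ((Matrix.ProjGenLinGroup.mk.comp σ₀.toMonoidHom).range ≃*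
      alternatingGroup (Fin 5)))
    (S : Finset ℕ) (hcptQ : isCompact_glFiniteIntegralLevel 2 ℚ)
    (πQ : CuspidalAutomorphicRepData 2 ℚ hcptQ) (hQ : QLevelCongruent ι σ₀ S hcptQ πQ)
    (K : Type) [Field K] [NumberField K] (hK : Module.finrank ℚ K = 2) :
    ∃ (hcpt : isCompact_glFiniteIntegralLevel 2 K) (π₀ : CuspidalAutomorphicRepData 2 K hcpt),
      π₀.1.IsRegularAlgebraic ∧
        ∀ v : HeightOneSpectrum (𝓞 K), (∀ ℓ ∈ S, ((ℓ : ℕ) : 𝓞 K) ∉ v.asIdeal) →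
          ∃ (α : Multiset ℂ) (P : Polynomial (PadicAlgCl 2)), π₀.1.HasSatakeParamAt v α ∧
            (σ₀.restrictField K).IsUnramifiedAt v ∧ (σ₀.restrictField K).HasFrobCharpolyAt v P ∧
            ∀ i : ℕ, ‖P.coeff i - (arithFrobPolyOfSatake ι v.residueCard 2 α).coeff i‖ < 1 := by
  sorry

/-- **Composition check**: the two first lemmas give the crux verbatim (the remaining conjuncts —
entrywise `ι`-transport, finite image, irreducibility, projective image `A₅` of `σ₀|_K` — are the
landed `ResidualBianchiDoorMod2.exists_padicModel_restrictField` /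
`restrictField_quadratic`). Stated with the facts as hypotheses. -/
theorem ResidualBianchiDoorLevel_of
    (hKW : ∀ (p : ℕ) [Fact p.Prime] (k : Type) [Field k] [TopologicalSpace k] [DiscreteTopology k],
      khare_wintenberger p k)
    (hBC : baseChange_cyclic_cuspidal) (hArch : ArthurClozel1989_strongLifting_archimedean)
    (hR1 : StrongLiftingAllFinite) :
    Summit.Langlands.Langlands.Theses.ParityBlindBianchi.ResidualBianchiDoorLevel := by
  sorry

end Summit.Langlands.Langlands.Cruxes.ResidualBianchiDoorLevel.SketchIdeator1
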